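import Mathlib.Data.Real.Basic
import Mathlib.Algebra.BigOperators.Ring.Finset
import Mathlib.Algebra.Order.BigOperators.Group.Finset
import Mathlib.Data.Fintype.Prod
import Mathlib.Order.UpperLower.Basic
import Mathlib.Tactic.Linarith
import Mathlib.Tactic.Ring
import Mathlib.Tactic.Positivity
import Mathlib.Tactic.FieldSimp
import HarnessLib
import HarnessLib.Audit

/-!
# `NoHeavyLowerTail` (crux stmt-CriticalPhenomena-4575), Sahi programme P4: face sums on a product of two topped posets
# (bookkeeping for the certificate of the OR of two disjoint principal blocks)

Support file (cell `prim-l12`, seat P4, generation 12; `--supports stmt-CriticalPhenomena-4575`).  No named facts, no sorries;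
standard axioms; def-free.

For finite posets `Q_A ∋ t_A`, `Q_B ∋ t_B` (distinguished points, in the application the greatest elements) a sum over
`X ⊆ Q_A × Q_B` splits into the four FACES `{a = t_A, b = t_B}`, `{a = t_A, b ≠ t_B}`, `{a ≠ t_A, b = t_B}`, `{a ≠ t_A, b ≠ t_B}`
(`sum_faces`); on the first three faces a product weight `ν_A(a)ν_B(b)` factors (`sum_face10_mul`, `sum_face01_mul`), face sums
over `univ` are block sums (`sum_face10_univ`, `sum_face01_univ`, `sum_face00_univ`), and for an up-set the `00`-face mass is dominated
by the `10`/`01`-face masses (`face00_le_face10`, `face00_le_face01`).  These feed `…SahiE3DnfTwoCertMain.cert_dnf_two`.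
-/

namespace Summit.CriticalPhenomena.PercolationContinuityZ3.Theorems.SahiE3DnfTwoCert

open Finset
open scoped BigOperators

variable {QA QB : Type*} [Fintype QA] [DecidableEq QA] [Fintype QB] [DecidableEq QB]

omit [Fintype QA] [Fintype QB] in
/-- Four-face decomposition of a sum over `X ⊆ Q_A × Q_B` relative to the points `t_A, t_B`. [folklore] -/
theorem sum_faces (tA : QA) (tB : QB) (X : Finset (QA × QB)) (φ : QA × QB → ℝ) :
    ∑ x ∈ X, φ x = (∑ x ∈ X.filter (fun x => x.1 = tA ∧ x.2 = tB), φ x)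
      + (∑ x ∈ X.filter (fun x => x.1 = tA ∧ x.2 ≠ tB), φ x)
      + (∑ x ∈ X.filter (fun x => x.1 ≠ tA ∧ x.2 = tB), φ x)
      + (∑ x ∈ X.filter (fun x => x.1 ≠ tA ∧ x.2 ≠ tB), φ x) := by
  rw [← Finset.sum_filter_add_sum_filter_not X (fun x => x.1 = tA) φ,
    ← Finset.sum_filter_add_sum_filter_not (X.filter fun x => x.1 = tA) (fun x => x.2 = tB) φ,
    ← Finset.sum_filter_add_sum_filter_not (X.filter fun x => ¬ x.1 = tA) (fun x => x.2 = tB) φ]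
  simp only [Finset.filter_filter]
  ring

omit [Fintype QA] [Fintype QB] in
/-- The `11`-face of `X` is `{(t_A,t_B)}` or empty. [folklore] -/
theorem sum_face11 (tA : QA) (tB : QB) (X : Finset (QA × QB)) (φ : QA × QB → ℝ) :
    ∑ x ∈ X.filter (fun x => x.1 = tA ∧ x.2 = tB), φ x = if (tA, tB) ∈ X then φ (tA, tB) else 0 := by
  have e : X.filter (fun x => x.1 = tA ∧ x.2 = tB) = if (tA, tB) ∈ X then {(tA, tB)} else ∅ := by
    ext ⟨a, b⟩
    simp only [Finset.mem_filter]
    split_ifs with h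
    · simp only [Finset.mem_singleton, Prod.mk.injEq]
      constructor
      · rintro ⟨_, rfl, rfl⟩; exact ⟨rfl, rfl⟩
      · rintro ⟨rfl, rfl⟩; exact ⟨h, rfl, rfl⟩
    · simp only [Finset.notMem_empty, iff_false, not_and]
      rintro hx rfl rfl; exact h hx
  rw [e]; split_ifs <;> simp

omit [Fintype QA] [Fintype QB] in
/-- On the `10`-face a product weight factors through `ν_A(t_A)`. [folklore] -/
theorem sum_face10_mul (tA : QA) (tB : QB) (X : Finset (QA × QB)) (νA : QA → ℝ) (ψ : QB → ℝ) :
    ∑ x ∈ X.filter (fun x => x.1 = tA ∧ x.2 ≠ tB), νA x.1 * ψ x.2 =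
      νA tA * ∑ x ∈ X.filter (fun x => x.1 = tA ∧ x.2 ≠ tB), ψ x.2 := by
  rw [Finset.mul_sum]
  exact Finset.sum_congr rfl fun x hx => by rw [(Finset.mem_filter.1 hx).2.1]

omit [Fintype QA] [Fintype QB] in
/-- On the `01`-face a product weight factors through `ν_B(t_B)`. [folklore] -/
theorem sum_face01_mul (tA : QA) (tB : QB) (X : Finset (QA × QB)) (ψ : QA → ℝ) (νB : QB → ℝ) :
    ∑ x ∈ X.filter (fun x => x.1 ≠ tA ∧ x.2 = tB), ψ x.1 * νB x.2 =
      νB tB * ∑ x ∈ X.filter (fun x => x.1 ≠ tA ∧ x.2 = tB), ψ x.1 := by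
  rw [Finset.mul_sum]
  exact Finset.sum_congr rfl fun x hx => by rw [(Finset.mem_filter.1 hx).2.2]; ring

omit [Fintype QA] in
/-- The `10`-face sum of a function of the second coordinate is a sum over the section `{b | (t_A, b) ∈ X, b ≠ t_B}`. [folklore] -/
theorem sum_face10_section (tA : QA) (tB : QB) (X : Finset (QA × QB)) (ψ : QB → ℝ) :
    ∑ x ∈ X.filter (fun x => x.1 = tA ∧ x.2 ≠ tB), ψ x.2 =
      ∑ b ∈ (univ.filter fun b => (tA, b) ∈ X).filter (fun b => b ≠ tB), ψ b := by
  have e : X.filter (fun x => x.1 = tA ∧ x.2 ≠ tB) =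
      ((univ.filter fun b => (tA, b) ∈ X).filter (fun b => b ≠ tB)).image (fun b => (tA, b)) := by
    ext ⟨a, b⟩
    simp only [Finset.mem_filter, Finset.mem_image, Finset.mem_univ, true_and, Prod.mk.injEq]
    constructor
    · rintro ⟨hx, rfl, hb⟩; exact ⟨b, ⟨hx, hb⟩, rfl, rfl⟩
    · rintro ⟨b', ⟨hx, hb⟩, rfl, rfl⟩; exact ⟨hx, rfl, hb⟩
  rw [e, Finset.sum_image]
  intro b _ b' _ h
  exact (Prod.mk.injEq _ _ _ _).mp h |>.2

omit [Fintype QB] in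
/-- The `01`-face sum of a function of the first coordinate is a sum over the section `{a | (a, t_B) ∈ X, a ≠ t_A}`. [folklore] -/
theorem sum_face01_section (tA : QA) (tB : QB) (X : Finset (QA × QB)) (ψ : QA → ℝ) :
    ∑ x ∈ X.filter (fun x => x.1 ≠ tA ∧ x.2 = tB), ψ x.1 =
      ∑ a ∈ (univ.filter fun a => (a, tB) ∈ X).filter (fun a => a ≠ tA), ψ a := by
  have e : X.filter (fun x => x.1 ≠ tA ∧ x.2 = tB) =
      ((univ.filter fun a => (a, tB) ∈ X).filter (fun a => a ≠ tA)).image (fun a => (a, tB)) := by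
    ext ⟨a, b⟩
    simp only [Finset.mem_filter, Finset.mem_image, Finset.mem_univ, true_and, Prod.mk.injEq]
    constructor
    · rintro ⟨hx, ha, rfl⟩; exact ⟨a, ⟨hx, ha⟩, rfl, rfl⟩
    · rintro ⟨a', ⟨hx, ha⟩, rfl, rfl⟩; exact ⟨hx, ha, rfl⟩
  rw [e, Finset.sum_image]
  intro a _ a' _ h
  exact (Prod.mk.injEq _ _ _ _).mp h |>.1


omit [Fintype QB] in
/-- Sum over `{x ∈ X | x.2 = c, x.1 ≠ t_A}` of a function of the first coordinate, as a section sum. [folklore] -/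
theorem sum_snd_fixed (tA : QA) (c : QB) (X : Finset (QA × QB)) (ψ : QA → ℝ) :
    ∑ x ∈ X.filter (fun x => x.1 ≠ tA ∧ x.2 = c), ψ x.1 =
      ∑ a ∈ (univ.filter fun a => (a, c) ∈ X).filter (fun a => a ≠ tA), ψ a := by
  have e : X.filter (fun x => x.1 ≠ tA ∧ x.2 = c) =
      ((univ.filter fun a => (a, c) ∈ X).filter (fun a => a ≠ tA)).image (fun a => (a, c)) := by
    ext ⟨a, b⟩
    simp only [Finset.mem_filter, Finset.mem_image, Finset.mem_univ, true_and, Prod.mk.injEq]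
    constructor
    · rintro ⟨hx, ha, rfl⟩; exact ⟨a, ⟨hx, ha⟩, rfl, rfl⟩
    · rintro ⟨a', ⟨hx, ha⟩, rfl, rfl⟩; exact ⟨hx, ha, rfl⟩
  rw [e, Finset.sum_image]
  intro a _ a' _ h
  exact (Prod.mk.injEq _ _ _ _).mp h |>.1

omit [Fintype QA] in
/-- Sum over `{x ∈ X | x.1 = c, x.2 ≠ t_B}` of a function of the second coordinate, as a section sum. [folklore] -/
theorem sum_fst_fixed (c : QA) (tB : QB) (X : Finset (QA × QB)) (ψ : QB → ℝ) :
    ∑ x ∈ X.filter (fun x => x.1 = c ∧ x.2 ≠ tB), ψ x.2 =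
      ∑ b ∈ (univ.filter fun b => (c, b) ∈ X).filter (fun b => b ≠ tB), ψ b := by
  have e : X.filter (fun x => x.1 = c ∧ x.2 ≠ tB) =
      ((univ.filter fun b => (c, b) ∈ X).filter (fun b => b ≠ tB)).image (fun b => (c, b)) := by
    ext ⟨a, b⟩
    simp only [Finset.mem_filter, Finset.mem_image, Finset.mem_univ, true_and, Prod.mk.injEq]
    constructor
    · rintro ⟨hx, rfl, hb⟩; exact ⟨b, ⟨hx, hb⟩, rfl, rfl⟩
    · rintro ⟨b', ⟨hx, hb⟩, rfl, rfl⟩; exact ⟨hx, rfl, hb⟩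
  rw [e, Finset.sum_image]
  intro b _ b' _ h
  exact (Prod.mk.injEq _ _ _ _).mp h |>.2

/-- Face `10` of `univ`: the block sum over `b ≠ t_B`. [folklore] -/
theorem sum_face10_univ (tA : QA) (tB : QB) (ψ : QB → ℝ) :
    ∑ x ∈ (univ : Finset (QA × QB)).filter (fun x => x.1 = tA ∧ x.2 ≠ tB), ψ x.2 =
      ∑ b ∈ univ.filter (fun b => b ≠ tB), ψ b := by
  rw [sum_face10_section]
  exact Finset.sum_congr (by ext b; simp) fun _ _ => rfl

/-- Face `01` of `univ`: the block sum over `a ≠ t_A`. [folklore] -/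
theorem sum_face01_univ (tA : QA) (tB : QB) (ψ : QA → ℝ) :
    ∑ x ∈ (univ : Finset (QA × QB)).filter (fun x => x.1 ≠ tA ∧ x.2 = tB), ψ x.1 =
      ∑ a ∈ univ.filter (fun a => a ≠ tA), ψ a := by
  rw [sum_face01_section]
  exact Finset.sum_congr (by ext a; simp) fun _ _ => rfl

/-- Face `00` of `univ` for a product weight: the product of the two block sums. [folklore] -/
theorem sum_face00_univ (tA : QA) (tB : QB) (νA : QA → ℝ) (νB : QB → ℝ) :
    ∑ x ∈ (univ : Finset (QA × QB)).filter (fun x => x.1 ≠ tA ∧ x.2 ≠ tB), νA x.1 * νB x.2 =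
      (∑ a ∈ univ.filter (fun a => a ≠ tA), νA a) * ∑ b ∈ univ.filter (fun b => b ≠ tB), νB b := by
  have e : (univ : Finset (QA × QB)).filter (fun x => x.1 ≠ tA ∧ x.2 ≠ tB) =
      (univ.filter fun a => a ≠ tA) ×ˢ (univ.filter fun b => b ≠ tB) := by
    ext ⟨a, b⟩; simp
  rw [e, Finset.sum_product, Finset.sum_mul_sum]

omit [DecidableEq QA] [DecidableEq QB] in
/-- The whole product: `Σ ν_A(a)ν_B(b) = (Σ ν_A)(Σ ν_B)`. [folklore] -/
theorem sum_prod_weight (νA : QA → ℝ) (νB : QB → ℝ) :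
    ∑ x : QA × QB, νA x.1 * νB x.2 = (∑ a, νA a) * ∑ b, νB b := by
  rw [Finset.sum_mul_sum, ← Finset.univ_product_univ, Finset.sum_product]

omit [Fintype QB] [DecidableEq QB] in
/-- Block sum = top + rest. [folklore] -/
theorem sum_top_add (t : QA) (ψ : QA → ℝ) : ∑ a, ψ a = ψ t + ∑ a ∈ univ.filter (fun a => a ≠ t), ψ a := by
  rw [← Finset.sum_filter_add_sum_filter_not univ (fun a => a = t) ψ]
  congr 1
  rw [Finset.filter_eq' univ t, if_pos (Finset.mem_univ t), Finset.sum_singleton]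

variable [PartialOrder QA] [PartialOrder QB]

/-- For an up-set `S` and `t_A` greatest: the `00`-face mass is at most `ν_A(Q_A ∖ t_A)` times the `10`-face mass
(pointwise `(a,b) ∈ S ⇒ (t_A,b) ∈ S`). [this work] -/
theorem face00_le_face10 {νA : QA → ℝ} {νB : QB → ℝ} (hνA : ∀ a, 0 ≤ νA a) (hνB : ∀ b, 0 ≤ νB b)
    (tA : QA) (htA : ∀ a, a ≤ tA) (tB : QB) {S : Finset (QA × QB)} (hS : IsUpperSet (S : Set (QA × QB))) :
    ∑ x ∈ S.filter (fun x => x.1 ≠ tA ∧ x.2 ≠ tB), νA x.1 * νB x.2 ≤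
      (∑ a ∈ univ.filter (fun a => a ≠ tA), νA a) * ∑ x ∈ S.filter (fun x => x.1 = tA ∧ x.2 ≠ tB), νB x.2 := by
  rw [sum_face10_section, Finset.sum_mul_sum, ← Finset.sum_product']
  -- the `00`-face embeds into the product of the two index sets
  have hsub : S.filter (fun x => x.1 ≠ tA ∧ x.2 ≠ tB) ⊆
      (univ.filter fun a => a ≠ tA) ×ˢ ((univ.filter fun b => (tA, b) ∈ S).filter fun b => b ≠ tB) := by
    rintro ⟨a, b⟩ hx
    simp only [Finset.mem_filter, Finset.mem_product, Finset.mem_univ, true_and] at hx ⊢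
    refine ⟨hx.2.1, ?_, hx.2.2⟩
    have hle : (a, b) ≤ (tA, b) := Prod.mk_le_mk.2 ⟨htA a, le_rfl⟩
    exact hS hle hx.1
  calc ∑ x ∈ S.filter (fun x => x.1 ≠ tA ∧ x.2 ≠ tB), νA x.1 * νB x.2
      ≤ ∑ x ∈ (univ.filter fun a => a ≠ tA) ×ˢ ((univ.filter fun b => (tA, b) ∈ S).filter fun b => b ≠ tB),
          νA x.1 * νB x.2 :=
        Finset.sum_le_sum_of_subset_of_nonneg hsub fun x _ _ => mul_nonneg (hνA _) (hνB _)
    _ = ∑ x ∈ (univ.filter fun a => a ≠ tA) ×ˢ ((univ.filter fun b => (tA, b) ∈ S).filter fun b => b ≠ tB),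
          νA x.1 * νB x.2 := rfl

/-- For an up-set `S` and `t_B` greatest: the `00`-face mass is at most `ν_B(Q_B ∖ t_B)` times the `01`-face mass. [this work] -/
theorem face00_le_face01 {νA : QA → ℝ} {νB : QB → ℝ} (hνA : ∀ a, 0 ≤ νA a) (hνB : ∀ b, 0 ≤ νB b)
    (tA : QA) (tB : QB) (htB : ∀ b, b ≤ tB) {S : Finset (QA × QB)} (hS : IsUpperSet (S : Set (QA × QB))) :
    ∑ x ∈ S.filter (fun x => x.1 ≠ tA ∧ x.2 ≠ tB), νA x.1 * νB x.2 ≤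
      (∑ b ∈ univ.filter (fun b => b ≠ tB), νB b) * ∑ x ∈ S.filter (fun x => x.1 ≠ tA ∧ x.2 = tB), νA x.1 := by
  rw [sum_face01_section, Finset.sum_mul_sum, ← Finset.sum_product']
  have hsub : S.filter (fun x => x.1 ≠ tA ∧ x.2 ≠ tB) ⊆
      (((univ.filter fun b => b ≠ tB) ×ˢ ((univ.filter fun a => (a, tB) ∈ S).filter fun a => a ≠ tA)).image
        fun y => (y.2, y.1)) := by
    rintro ⟨a, b⟩ hx
    simp only [Finset.mem_filter, Finset.mem_image, Finset.mem_product, Finset.mem_univ, true_and, Prod.mk.injEq,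
      Prod.exists] at hx ⊢
    have hle : (a, b) ≤ (a, tB) := Prod.mk_le_mk.2 ⟨le_rfl, htB b⟩
    exact ⟨b, a, ⟨hx.2.2, hS hle hx.1, hx.2.1⟩, rfl, rfl⟩
  calc ∑ x ∈ S.filter (fun x => x.1 ≠ tA ∧ x.2 ≠ tB), νA x.1 * νB x.2
      ≤ ∑ x ∈ (((univ.filter fun b => b ≠ tB) ×ˢ ((univ.filter fun a => (a, tB) ∈ S).filter fun a => a ≠ tA)).image
          fun y => (y.2, y.1)), νA x.1 * νB x.2 :=
        Finset.sum_le_sum_of_subset_of_nonneg hsub fun x _ _ => mul_nonneg (hνA _) (hνB _)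
    _ = ∑ y ∈ (univ.filter fun b => b ≠ tB) ×ˢ ((univ.filter fun a => (a, tB) ∈ S).filter fun a => a ≠ tA),
          νB y.1 * νA y.2 := by
        rw [Finset.sum_image]
        · exact Finset.sum_congr rfl fun y _ => by ring
        · rintro ⟨b, a⟩ _ ⟨b', a'⟩ _ h
          simp only [Prod.mk.injEq] at h
          rw [h.1, h.2]

end Summit.CriticalPhenomena.PercolationContinuityZ3.Theorems.SahiE3DnfTwoCert
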